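import Summits.Ventures.HSemireg.FormulaNSurfacePowerPerQ

/-!
# Venture HSemireg — FORMULA-N: ONE per-`q` enumerator for the `n`-fold box of `m`-dimensional point-pair factors,
# `G_{m,n}(t,u) = Σ_z C(n,z)·(1 + u^m + ⋯ + u^{zm})·(Q_m(t,u) − 1 − u^m)^{n−z}`, with BOTH kernel per-q laws as its edges:
# `m = 2` (surface powers, all `n`): `G_{2,n} = S_n` (p10's `spGen`); `n = 2` (two factors, all `m`): `G_{m,2} = Q_m² − u^m`

HONEST FRAMING. Part of the Lean index of the computation cell `pub-hsemireg` (seat p10 gen 3, Sunday typer «UNIFORM-IN-n»).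
INTEGER POLYNOMIAL ARITHMETIC ONLY: no variety, no cohomology theory, no sheaf, no exterior algebra even, no semiregularity map is
constructed here; nothing here says that HC / HC_CM / HC_AV holds; no Literature fact is declared or used.  Custodian versions:
STRUCTURE.md v1.0-SIGNED 9b196a05977dd067 (§1.1 C13 «per-q law [t^m u^q]Q_n²», C10 surface powers), theory/FORMULA-N.md PART A §4.1″ (th-6).

WHAT IS TYPED.  The two kernel per-`q` RANK laws of the tree —
(i) th-6's per-q law for th-7's TWO-FACTOR box of `m`-dimensional point-pair factors, `rank_q = [t^k u^q] Q_m(t,u)²` for `k ≥ 1`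
(`WedgeBoxPerQCount.lean`, p10 gen 2; `Q_m = (1+t)^m + (u+t)^m − t^m`), and (ii) the `n`-FOLD SURFACE box (`m = 2`),
`rank_q = spCount n k q = [t^k u^q] S_n(t,u)` (`WedgeSurfacePowersPerQRank.lean`, p10 gen 3) — are the two edges of ONE
enumerator: with the CLASS POLYNOMIAL `R_m := Q_m − 1 − u^m` of one factor (its canonical non-empty local sources) and
`G_{m,n}(t,u) := Σ_z C(n,z)·(1 + u^m + ⋯ + u^{zm})·R_m^{n−z}` (a class with `z` empty factors counted ONCE in each block
`q_f + jm`, `j ≤ z` — each empty factor's source `1` being ONE vector with components `1` (`q = 0`) and `pt` (`q = m`)):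
* `genGen_two : G_{2,n} = S_n` (so `[t^k u^q] G_{2,n} = spCount n k q`, `coeff_genGen_two`);
* `genGen_two_factors : G_{m,2} = Q_m² − u^m` (so `[t^k u^q] G_{m,2} = blockCount m k q` for `k ≥ 1`, `coeff_genGen_two_factors`,
  and the degree-0 block `q = m` is counted once — `WedgeBoxPerQOverlap.perq_law_fails_in_degree_zero`);
* `genGen_one : G_{m,1} = Q_m` (one factor: the u-refined atoms, THEOREM T's two pieces);
* a computable coefficient `genCount` (`coeff_genGen`, `m ≥ 1`), cross-checks of both edges by `decide`, and PRE-REGISTERED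
  PREDICTIONS for `m = 3` (threefold factors), `n = 3`: degrees 1–3 (`genCount_predictions_three`).
WHAT IS NOT HERE: the RANK theorem for general `(m, n)` — typed only on the two edges `n = 2` (all `m`) and `m = 2` (all `n`); for
`m, n ≥ 3` the statement «rank(q-block of θ ↦ θ ∧ (f₁ ∧ ⋯ ∧ f_n) ∣ ⋀^k K^{2mn}) = [t^k u^q] G_{m,n}» is a CONJECTURE / prediction of
this file (the class decomposition of `WedgeSurfacePowersPerQ*.lean` goes through verbatim with `Fin 4 ↦ Fin 2m`, but its local
tables are no longer finite checks).  Nothing Ext-side.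
-/

open Finset Polynomial

namespace Summit.Ventures.HSemireg.FormulaN.Uniform

/-- the CLASS POLYNOMIAL of one `m`-dimensional point-pair factor: `R_m(t,u) := Q_m(t,u) − 1 − u^m
= ((1+t)^m − 1 − t^m) + ((u+t)^m − u^m)` — the canonical NON-EMPTY local sources weighted `t^{degree} u^{q-part}`
(`t ⊆ Y`, `1 ≤ |t| ≤ m−1`: `C(m,j) t^j`; `t ⊆ X`, `1 ≤ |t| ≤ m`: `C(m,j) t^j u^{m−j}`; the empty source, ONE vector with the two
components `1` (`q = 0`) and `u^m` (`q = m`), is removed). -/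
noncomputable def Rb (m : ℕ) : ℤ[X][X] := Q m - 1 - C (X ^ m)

/-- **THE GENERAL CORRECTED PER-q GENERATING FUNCTION** `G_{m,n}(t,u) := Σ_z C(n,z)·(1 + u^m + ⋯ + u^{zm})·R_m(t,u)^{n−z}`:
a class with `z` empty factors is counted ONCE in each block `q_f + jm`, `0 ≤ j ≤ z`. -/
noncomputable def genGen (m n : ℕ) : ℤ[X][X] :=
  ∑ z ∈ range (n + 1), C (∑ j ∈ range (z + 1), (X : ℤ[X]) ^ (m * j)) * Rb m ^ (n - z) * (n.choose z : ℤ[X][X])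

/-- `R_2 = t(t + 2 + 2u)` (`= 2t(1+u) + t²`, the surface factor's class polynomial of `FormulaNSurfacePowerPerQ.classCount`). -/
theorem Rb_two : Rb 2 = X * (X + C (2 + 2 * X)) := by
  rw [Rb, Q_two_eq, map_add, map_pow, map_one]
  ring

/-- **EDGE `m = 2`: `G_{2,n} = S_n`** (p10 gen 2's corrected surface-power generating function `spGen`, whose coefficients are
`spCount n k q` = the kernel per-q RANKS of the `n`-fold surface box, `WedgeSurfacePowersPerQRank.lean`). -/
theorem genGen_two (n : ℕ) : genGen 2 n = spGen n := by
  rw [genGen, spGen]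
  refine Finset.sum_congr rfl fun z _ => ?_
  rw [Rb_two]

/-- **EDGE `n = 2`: `G_{m,2} = Q_m² − u^m`** — two factors: `R² + 2(1 + u^m)R + (1 + u^m + u^{2m}) = (R + 1 + u^m)² − u^m`;
so `[t^k u^q] G_{m,2} = [t^k u^q] Q_m²` for every `k ≥ 1` (th-6's per-q law `blockCount`, the kernel per-q RANKS of th-7's two-factor
box, `WedgeBoxPerQCount.lean`), while in degree `0` the block `q = m` is counted ONCE (`WedgeBoxPerQOverlap.perq_law_fails_in_degree_zero`). -/
theorem genGen_two_factors (m : ℕ) : genGen m 2 = Q m ^ 2 - C (X ^ m) := by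
  have hQ : Q m = Rb m + 1 + C (X ^ m) := by rw [Rb]; ring
  rw [genGen]
  simp only [Finset.sum_range_succ, Finset.sum_range_zero, zero_add, Nat.choose_zero_right, Nat.choose_one_right,
    Nat.choose_self, Nat.cast_one, Nat.cast_ofNat, mul_one, mul_zero, pow_zero, Nat.sub_zero, Nat.sub_self, pow_one,
    Nat.add_one_sub_one, map_add, map_one, map_pow, map_zero, hQ]
  ring

/-- hence **`[t^k u^q] G_{m,2} = blockCount m k q` for every `m`, `k ≥ 1`, `q`**. -/
theorem coeff_genGen_two_factors {m k : ℕ} (hk : 1 ≤ k) (q : ℕ) :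
    ((genGen m 2).coeff k).coeff q = (blockCount m k q : ℤ) := by
  rw [genGen_two_factors, coeff_sub, coeff_C, if_neg (by omega), sub_zero, coeff_Q_sq]

/-- and **`[t^k u^q] G_{2,n} = spCount n k q` for every `n`, `k`, `q`**. -/
theorem coeff_genGen_two (n k q : ℕ) : ((genGen 2 n).coeff k).coeff q = (spCount n k q : ℤ) := by
  rw [genGen_two, coeff_spGen]


/-- **EDGE `n = 1`: `G_{m,1} = Q_m`** — one factor: the u-refined point atoms themselves (`qAtom`; th-7's two `K`-isotypic pieces
`C(m,k)` at `q = 0` and `q = m − k`, THEOREM T). -/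
theorem genGen_one (m : ℕ) : genGen m 1 = Q m := by
  rw [genGen]
  simp only [Finset.sum_range_succ, Finset.sum_range_zero, zero_add, Nat.choose_zero_right, Nat.choose_self, Nat.cast_one,
    mul_one, mul_zero, pow_zero, Nat.sub_zero, Nat.sub_self, pow_one, map_add, map_one, map_zero, Rb]
  ring

/-! ## Computable coefficients and the pre-registered `m = 3` rows -/

/-- `[t^j u^q] R_m`: the point atom without its degree-0 part. -/
def atomR (m j q : ℕ) : ℕ := if j = 0 then 0 else qAtom m j q

/-- `[t^j u^q] R_m = atomR m j q` (`m ≥ 1`). -/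
theorem coeff_Rb {m : ℕ} (hm : 1 ≤ m) (j q : ℕ) : ((Rb m).coeff j).coeff q = (atomR m j q : ℤ) := by
  simp only [Rb, coeff_sub, coeff_one, coeff_C, coeff_Q, atomR]
  by_cases hj : j = 0
  · subst hj
    rw [if_pos rfl, if_pos rfl, if_pos rfl, coeff_one, coeff_X_pow, qAtom, Nat.choose_zero_right, Nat.sub_zero]
    push_cast
    split_ifs <;> omega
  · rw [if_neg hj, if_neg hj, if_neg hj, Polynomial.coeff_zero, sub_zero, sub_zero]

/-- `[t^k u^q] R_m^p`, computably (iterated Cauchy product). -/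
def rbPow (m : ℕ) : ℕ → ℕ → ℕ → ℕ
  | 0, k, q => if k = 0 ∧ q = 0 then 1 else 0
  | p + 1, k, q => ∑ ab ∈ antidiagonal k, ∑ pr ∈ antidiagonal q, rbPow m p ab.1 pr.1 * atomR m ab.2 pr.2

/-- `[t^k u^q] R_m^p = rbPow m p k q` (`m ≥ 1`). -/
theorem coeff_Rb_pow {m : ℕ} (hm : 1 ≤ m) : ∀ p k q : ℕ, ((Rb m ^ p).coeff k).coeff q = (rbPow m p k q : ℤ)
  | 0, k, q => by
    rw [pow_zero, coeff_one, rbPow]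
    split_ifs with h1 h2 h2
    · subst h1; rw [coeff_one, if_pos h2.2]; simp
    · subst h1; rw [coeff_one, if_neg (fun h => h2 ⟨rfl, h⟩)]; simp
    · exact absurd h2.1 h1
    · rw [Polynomial.coeff_zero]; simp
  | p + 1, k, q => by
    rw [pow_succ, coeff_mul, finsetSum_coeff, rbPow]
    push_cast
    refine Finset.sum_congr rfl fun ab _ => ?_
    rw [coeff_mul]
    refine Finset.sum_congr rfl fun pr _ => ?_
    rw [coeff_Rb_pow hm p, coeff_Rb hm]

/-- **the general corrected per-q enumerator, computably**: `genCount m n k q = Σ_z C(n,z) Σ_{j ≤ z, mj ≤ q} [t^k u^{q−mj}] R_m^{n−z}`. -/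
def genCount (m n k q : ℕ) : ℕ :=
  ∑ z ∈ range (n + 1), n.choose z * ∑ j ∈ range (z + 1), (if m * j ≤ q then rbPow m (n - z) k (q - m * j) else 0)

/-- inner coefficient: `[u^q] (1 + u^m + ⋯ + u^{zm}) · r = Σ_{j ≤ z, mj ≤ q} [u^{q−mj}] r`. -/
theorem coeff_sum_X_pow_mul_step (m z q : ℕ) (r : Polynomial ℤ) :
    ((∑ j ∈ range (z + 1), (X : Polynomial ℤ) ^ (m * j)) * r).coeff q =
      ∑ j ∈ range (z + 1), (if m * j ≤ q then r.coeff (q - m * j) else 0) := by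
  rw [Finset.sum_mul, finsetSum_coeff]
  refine Finset.sum_congr rfl fun j _ => ?_
  rw [coeff_X_pow_mul']

/-- **`[t^k u^q] G_{m,n} = genCount m n k q`** for every `m ≥ 1`, `n`, `k`, `q`. -/
theorem coeff_genGen {m : ℕ} (hm : 1 ≤ m) (n k q : ℕ) : ((genGen m n).coeff k).coeff q = (genCount m n k q : ℤ) := by
  rw [genGen, finsetSum_coeff, finsetSum_coeff, genCount]
  push_cast
  refine Finset.sum_congr rfl fun z _ => ?_
  rw [coeff_mul_natCast, coeff_C_mul, coeff_mul_natCast, coeff_sum_X_pow_mul_step, mul_comm _ ((n.choose z : ℤ))]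
  congr 1
  refine Finset.sum_congr rfl fun j _ => ?_
  split_ifs
  · rw [coeff_Rb_pow hm]
  · rfl


/-- computable cross-checks of the two edges: `genCount 2 n = spCount n` on the measured surface-power rows (`n = 3, 4`, degree 2),
and `genCount m 2 k q = blockCount m k q` for `k ≥ 1` at `m = 3` (degrees 1–3) while degree `0` reads `(1,0,0,1,0,0,1)` against
`blockCount 3 0 = (1,0,0,2,0,0,1)` (the `m ≥ 1` exception). -/
theorem genCount_edges_check :
    (List.range 5).map (genCount 2 3 2) = (List.range 5).map (spCount 3 2) ∧
    (List.range 7).map (genCount 2 4 2) = (List.range 7).map (spCount 4 2) ∧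
    (∀ k ∈ [1, 2, 3], ∀ q ∈ List.range 7, genCount 3 2 k q = blockCount 3 k q) ∧
    (List.range 7).map (genCount 3 2 0) = [1, 0, 0, 1, 0, 0, 1] ∧ (List.range 7).map (blockCount 3 0) = [1, 0, 0, 2, 0, 0, 1] := by
  decide +kernel

/-- **PRE-REGISTERED PREDICTIONS beyond both edges** (`m = 3`: the `n`-fold box of point-pair classes of THREEFOLD factors,
`6n` generators; no measured row exists at registration, 2026-08-23): `n = 3`, degrees 1, 2, 3 (blocks `q = 0, …, 9`):
`(9,0,9,9,0,9,9,0,9,0)`, `(36,9,54,36,36,54,9,36,0,0)` (sum `270 = 126 + 3·48 = [t²]P_3³ + 3·[t²]P_3²`, `P_3 = 1 + 6t + 6t² + t³`),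
`(84,54,135,111,135,54,84,0,0,0)`. -/
theorem genCount_predictions_three :
    (List.range 10).map (genCount 3 3 1) = [9, 0, 9, 9, 0, 9, 9, 0, 9, 0] ∧
    (List.range 10).map (genCount 3 3 2) = [36, 9, 54, 36, 36, 54, 9, 36, 0, 0] ∧
    (List.range 10).map (genCount 3 3 3) = [84, 54, 135, 111, 135, 54, 84, 0, 0, 0] := by
  decide +kernel

end Summit.Ventures.HSemireg.FormulaN.Uniform
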